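import Summits.QuantumFields.BalabanUV.Beta.FP.ConstrainedGhostIRLetters
import Summits.QuantumFields.BalabanUV.Beta.FP.ConstrainedGhostIRSecond
import Summits.QuantumFields.BalabanUV.Beta.FP.CoarseInverseScalar
import Summits.QuantumFields.BalabanUV.Beta.FP.BlockAveragedKernelLegs

/-!
# `BalabanUV.Beta.FP.ConstrainedGhostIRFinal` — road «FP» for binder row D1, row H′2-IR ∕ IR-4 (R-FP-21 (A2), «the two-line unconditional corollary,
# yours, last»): THE SCALE-`N` LETTERS OF THE CONSTRAINED GHOST's WOODBURY REMAINDER ON `ℤ⁴`, UNCONDITIONALLY —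
# `|ghostRem N x x′| ≤ K₀·N⁻²`, `|ghostRem N (x+e_i) x′ − ghostRem N x x′| ≤ K₁·N⁻³`, `|Σ_κ Δ_κ⁺Δ_κ⁻ ghostRem N (·,x′)| ≤ K₂·N⁻⁴` (trace channel, log-free)
# for ALL `N ≥ 1`, `x`, `x′`, with `K₀, K₁, K₂` EXPLICIT functions of the tree's constants (`TwoPowerLegs.free`, pv23's `cInv 4 1`, `deltaInv 4 1`) and FREE of `N`

HONEST DEPENDENCY (page 1, mandatory): continuum YM on T⁴ ⇐ BetaPertH ∧ nine spine estimates (0/9 proved); BetaPertH ⇐ (D1) ∧ (D4) ∧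
CAP+tail; G-an2-4 gates asym, D1 and NE2/3/4.  HONEST FRAMING (cell contract, verbatim): «discharging `BetaPertH` makes Bałaban's UV
stability UNCONDITIONAL — a real constructive-QFT result; it is NOT the continuum limit and NOT the Clay problem.»  THIS MODULE is the ASSEMBLY
of kernel-checked inputs BY NAME — leaf-06's IR-4-IF `FP/ConstrainedGhostIR` and IR-4b `FP/CoarseInverseScalar` ((H-CINV) as a theorem:
`hasSum_coarseInv_mul_bracket'`, `abs_coarseInv_le'`, `dist_eq_supNorm`, over pv23's `actionKer` column), gan24-formalise-leaf-04's IR-1-GEN PART 4∕5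
(`BlockAveragedKernelScalar`, `BlockAveragedKernelLegs.letter_free`∕`letterDiff_free`), leaf-05-g9's IR-4a (`ConstrainedGhostIRCoarse`,
`ConstrainedGhostIRLetters`, `ConstrainedGhostIRSecond`, `LatticeConvolutionBounds`); [folklore] bookkeeping, no `def`, no `def … : Prop`,
nothing cited, 0 sorry.  WHAT IT IS: the ghost half of row H′2-IR's near-region letters (E-FP-5-2 exact powers (T0), (T1), and the log-free trace
channel of (T2)) for an2's block-constrained massless scalar Green kernel on `ℤ⁴`, uniformly in the block side — a lemma toward `hbook`-MEAN of road FP;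
it discharges NOTHING of `hasym`∕D1 by itself.  0∕4 binders of row D1; NOT D1, NOT BetaPertH, NOT continuum, NOT Clay.

ABSOLUTE RULE (cell charter, verbatim): «No internally-minted statement may enter as a cited fact. Every hypothesis is either kernel-proved in
this package or a verbatim quotation of a PUBLISHED theorem with page reference. The manuscript(s) under audit are NOT citable for their own
disputed steps — they are the thing under adjudication; programme-internal (2001/route/tribunal) claims are never citable.»

CONTENT. §1 the coarse inverse `C u v := (N⁶)⁻¹·actionKer (N−1) 1 u v` satisfies (H-CINV) in this lineage's polynomial spelling (`coarseInv_hC`,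
`κ = (cInv 4 1 + 1)·N⁻⁶·e^δ·5!∕δ⁵`, `δ = deltaInv 4 1`) and `hCM` (leaf-06's `hasSum_coarseInv_mul_bracket'` verbatim); §2 **`abs_ghostRem_le`** (T0),
**`abs_ghostRem_sub_le`** (T1), **`abs_trace_secondDiff_ghostRem_le`** (T2-trace), **`abs_mixedSecondDiff_ghostRem_le`** (T2-sup, `μ ≠ ν`, WITH the block-edge
`log 3N` of gan24's `abs_blockAvg_fwdDiff₂_le_profile_marginal`) — hypotheses: `1 ≤ N` (and `μ ≠ ν`) ONLY.  (T2-win) (windowed, log-free) is NOT here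
(no windowed (D2) letter in the tree); the diagonal `μ = ν` sup letter is NOT here (no diagonal second-difference leg letter in the tree).
Provenance: D1 formalisation swarm, unit b2b-balaban-beta-d1-formalise-leaf-05 gen 9 (prover-b2b-balaban-beta-d1-formalise-leaf-05-g9-0),
2026-08-20; `LEAVES-FP.md` row H′2-IR ∕ IR-4a (final).  [folklore], 0 def, 0 cite, 0 sorry.
-/

namespace Summit.QuantumFields.BalabanUV.Beta.FP.ConstrainedGhostIRFinal

open Finset
open scoped BigOperators
open Literature.Probability.LatticeModels (latticeGreen)
open Literature.MathematicalPhysics.QuantumFieldTheory.Balaban1983to89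
open B6QGQDecay237 (cInv deltaInv cInv_pos deltaInv_pos)
open B5Hk165ActionZd (actionKer)
open Literature.MathematicalPhysics.QuantumFieldTheory.Balaban1983to89.Beta
open AffineAveraging (box toSite blockSum unitVec)
open Literature.MathematicalPhysics.QuantumFieldTheory.LatticeForm (quo)
open ScalarBlockKKT (Ws)
open Literature.MathematicalPhysics.QuantumFieldTheory.Balaban1983to89.Beta.DyadicShell (Pt supNorm)
open Literature.MathematicalPhysics.QuantumFieldTheory.Balaban1983to89.Beta.TwoPowerLegs (free)
open Literature.MathematicalPhysics.QuantumFieldTheory.Balaban1983to89.Beta.BubbleTransfer (c4)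
open Summit.QuantumFields.BalabanUV.Beta.FP.ConstrainedGhost (ghostRem)
open Summit.QuantumFields.BalabanUV.Beta.FP.ConstrainedGhostIRCoarse (coarseInv_poly_of_exp)
open Summit.QuantumFields.BalabanUV.Beta.FP.ConstrainedGhostIRLetters (abs_ghostRem_le_of_legs abs_ghostRem_sub_le_of_legs letterOsc letterS'')
open Summit.QuantumFields.BalabanUV.Beta.FP.ConstrainedGhostIRSecond (abs_trace_secondDiff_ghostRem_le_of_coarseInv abs_secondDiff_ghostRem_le_of_coarseInv)
open Summit.QuantumFields.BalabanUV.Beta.FP.CoarseInverseScalar (hasSum_coarseInv_mul_bracket' abs_coarseInv_le' dist_eq_supNorm)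
open Summit.QuantumFields.BalabanUV.Beta.FP.BlockAveragedKernelLegs (letter_free letterDiff_free letterDiff₂_free)

variable {N : ℕ} [NeZero N]

/-! ## §1 (H-CINV) holds for pv23's coarse inverse, in this lineage's spelling -/

/-- [folklore] **THE DECAY LETTER `hC`**: `|N⁻⁶·actionKer (N−1) 1 u v| ≤ κ∕(‖u−v‖∞+1)⁵` with `κ = (cInv 4 1 + 1)·N⁻⁶·(e^δ·5!∕δ⁵)`, `δ = deltaInv 4 1`
(leaf-06's `abs_coarseInv_le'` + `dist_eq_supNorm` + `coarseInv_poly_of_exp`). -/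
theorem coarseInv_hC (u v : Pt) :
    |((((N : ℝ)) ^ (4 + 2))⁻¹ * actionKer (N - 1) 1 u v)|
      ≤ ((cInv 4 1 + 1) * (((N : ℝ)) ^ (4 + 2))⁻¹ * (Real.exp (deltaInv 4 1) * (Nat.factorial 5) / deltaInv 4 1 ^ 5))
        / ((supNorm (u - v) : ℝ) + 1) ^ 5 := by
  have hc : 0 ≤ (cInv 4 1 + 1) * (((N : ℝ)) ^ (4 + 2))⁻¹ := by have := (cInv_pos 4 one_pos).le; positivity
  have hexp : ∀ u v : Pt, |((((N : ℝ)) ^ (4 + 2))⁻¹ * actionKer (N - 1) 1 u v)|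
      ≤ (cInv 4 1 + 1) * (((N : ℝ)) ^ (4 + 2))⁻¹ * Real.exp (-(deltaInv 4 1 * supNorm (u - v))) := by
    intro u v
    have h := abs_coarseInv_le' (d := 4) N u v
    rwa [dist_eq_supNorm] at h
  exact coarseInv_poly_of_exp (deltaInv_pos 4 one_pos) hc hexp u v

/-! ## §2 The letters, unconditionally -/

/-- [folklore] **(T0) — `|ghostRem N x x′| ≤ K₀·N⁻²` FOR ALL `N ≥ 1`, `x`, `x′`**, with the EXPLICIT N-free constant
`K₀ = 162·(36·104977·C₀)·(1296·cC·(6912·104977·C₁) + 1)`, `C₀ = 4(U + c₄ + B)`, `C₁ = 8(2U + 2c₄ + Bgrad)` of `TwoPowerLegs.free`,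
`cC = (cInv 4 1 + 1)·e^δ·5!∕δ⁵`, `δ = deltaInv 4 1`. -/
theorem abs_ghostRem_le (hN : 1 ≤ N) (x x' : Pt) :
    |ghostRem (d := 3) N x x'|
      ≤ 162 * (36 * 104977 * (4 * (free.U + c4 + free.B)))
          * (1296 * ((cInv 4 1 + 1) * (Real.exp (deltaInv 4 1) * (Nat.factorial 5) / deltaInv 4 1 ^ 5))
              * (6912 * 104977 * (8 * (2 * free.U + 2 * c4 + free.Bgrad))) + 1) * ((N : ℝ) ^ 2)⁻¹ := by
  have h := abs_ghostRem_le_of_legs (N := N) (fun u v => (((N : ℝ)) ^ (4 + 2))⁻¹ * actionKer (N - 1) 1 u v) hN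
    (coarseInv_hC (N := N)) (fun u w => hasSum_coarseInv_mul_bracket' (d := 4) (by norm_num) N u w) letter_free
    (fun i z => letterDiff_free i z) x x'
  refine h.trans (le_of_eq ?_)
  have h6 : (((N : ℝ)) ^ (4 + 2))⁻¹ * (N : ℝ) ^ 6 = 1 := by rw [show 4 + 2 = 6 by norm_num]; field_simp
  have e : 1296 * ((cInv 4 1 + 1) * (((N : ℝ)) ^ (4 + 2))⁻¹ * (Real.exp (deltaInv 4 1) * (Nat.factorial 5) / deltaInv 4 1 ^ 5))
      * (6912 * 104977 * (8 * (2 * free.U + 2 * c4 + free.Bgrad))) * (N : ℝ) ^ 6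
      = 1296 * ((cInv 4 1 + 1) * (Real.exp (deltaInv 4 1) * (Nat.factorial 5) / deltaInv 4 1 ^ 5))
        * (6912 * 104977 * (8 * (2 * free.U + 2 * c4 + free.Bgrad))) := by
    calc _ = 1296 * ((cInv 4 1 + 1) * (Real.exp (deltaInv 4 1) * (Nat.factorial 5) / deltaInv 4 1 ^ 5))
          * (6912 * 104977 * (8 * (2 * free.U + 2 * c4 + free.Bgrad))) * ((((N : ℝ)) ^ (4 + 2))⁻¹ * (N : ℝ) ^ 6) := by ring
      _ = _ := by rw [h6, mul_one]
  rw [e]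

/-- [folklore] **(T1) — `|ghostRem N (x+e_i) x′ − ghostRem N x x′| ≤ K₁·N⁻³` FOR ALL `N ≥ 1`, `x`, `x′`, `i`**, `K₁` explicit and N-free. -/
theorem abs_ghostRem_sub_le (hN : 1 ≤ N) (i : Fin 4) (x x' : Pt) :
    |ghostRem (d := 3) N (x + unitVec i) x' - ghostRem (d := 3) N x x'|
      ≤ 162 * (216 * 104977 * (8 * (2 * free.U + 2 * c4 + free.Bgrad)))
          * (1296 * ((cInv 4 1 + 1) * (Real.exp (deltaInv 4 1) * (Nat.factorial 5) / deltaInv 4 1 ^ 5))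
              * (6912 * 104977 * (8 * (2 * free.U + 2 * c4 + free.Bgrad))) + 1) * ((N : ℝ) ^ 3)⁻¹ := by
  have h := abs_ghostRem_sub_le_of_legs (N := N) (fun u v => (((N : ℝ)) ^ (4 + 2))⁻¹ * actionKer (N - 1) 1 u v) hN
    (coarseInv_hC (N := N)) (fun u w => hasSum_coarseInv_mul_bracket' (d := 4) (by norm_num) N u w)
    (fun i z => letterDiff_free i z) i x x'
  refine h.trans (le_of_eq ?_)
  have h6 : (((N : ℝ)) ^ (4 + 2))⁻¹ * (N : ℝ) ^ 6 = 1 := by rw [show 4 + 2 = 6 by norm_num]; field_simp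
  have e : 1296 * ((cInv 4 1 + 1) * (((N : ℝ)) ^ (4 + 2))⁻¹ * (Real.exp (deltaInv 4 1) * (Nat.factorial 5) / deltaInv 4 1 ^ 5))
      * (6912 * 104977 * (8 * (2 * free.U + 2 * c4 + free.Bgrad))) * (N : ℝ) ^ 6
      = 1296 * ((cInv 4 1 + 1) * (Real.exp (deltaInv 4 1) * (Nat.factorial 5) / deltaInv 4 1 ^ 5))
        * (6912 * 104977 * (8 * (2 * free.U + 2 * c4 + free.Bgrad))) := by
    calc _ = 1296 * ((cInv 4 1 + 1) * (Real.exp (deltaInv 4 1) * (Nat.factorial 5) / deltaInv 4 1 ^ 5))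
          * (6912 * 104977 * (8 * (2 * free.U + 2 * c4 + free.Bgrad))) * ((((N : ℝ)) ^ (4 + 2))⁻¹ * (N : ℝ) ^ 6) := by ring
      _ = _ := by rw [h6, mul_one]
  rw [e]

/-- [folklore] **(T2-trace) — LOG-FREE: `|Σ_κ (ghostRem N (x+e_κ) x′ − 2·ghostRem N x x′ + ghostRem N (x−e_κ) x′)| ≤ K₂·N⁻⁴` FOR ALL `N ≥ 1`, `x`, `x′`**,
`K₂ = 1296·cC·(6912·104977·C₁) + 1` explicit and N-free. -/
theorem abs_trace_secondDiff_ghostRem_le (hN : 1 ≤ N) (x x' : Pt) :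
    |∑ κ : Fin (3 + 1), (ghostRem (d := 3) N (x + unitVec κ) x' - 2 * ghostRem (d := 3) N x x' + ghostRem (d := 3) N (x - unitVec κ) x')|
      ≤ (1296 * ((cInv 4 1 + 1) * (Real.exp (deltaInv 4 1) * (Nat.factorial 5) / deltaInv 4 1 ^ 5))
          * (6912 * 104977 * (8 * (2 * free.U + 2 * c4 + free.Bgrad))) + 1) * ((N : ℝ) ^ 4)⁻¹ := by
  have h := abs_trace_secondDiff_ghostRem_le_of_coarseInv (N := N) (fun u v => (((N : ℝ)) ^ (4 + 2))⁻¹ * actionKer (N - 1) 1 u v) hN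
    (coarseInv_hC (N := N)) (fun u w => hasSum_coarseInv_mul_bracket' (d := 4) (by norm_num) N u w)
    (fun a b v hab => letterOsc hN (fun i z => letterDiff_free i z) a b v hab) x x'
  refine h.trans (le_of_eq ?_)
  have h6 : (((N : ℝ)) ^ (4 + 2))⁻¹ * (N : ℝ) ^ 6 = 1 := by rw [show 4 + 2 = 6 by norm_num]; field_simp
  have e : 1296 * ((cInv 4 1 + 1) * (((N : ℝ)) ^ (4 + 2))⁻¹ * (Real.exp (deltaInv 4 1) * (Nat.factorial 5) / deltaInv 4 1 ^ 5))
      * (6912 * 104977 * (8 * (2 * free.U + 2 * c4 + free.Bgrad))) * (N : ℝ) ^ 6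
      = 1296 * ((cInv 4 1 + 1) * (Real.exp (deltaInv 4 1) * (Nat.factorial 5) / deltaInv 4 1 ^ 5))
        * (6912 * 104977 * (8 * (2 * free.U + 2 * c4 + free.Bgrad))) := by
    calc _ = 1296 * ((cInv 4 1 + 1) * (Real.exp (deltaInv 4 1) * (Nat.factorial 5) / deltaInv 4 1 ^ 5))
          * (6912 * 104977 * (8 * (2 * free.U + 2 * c4 + free.Bgrad))) * ((((N : ℝ)) ^ (4 + 2))⁻¹ * (N : ℝ) ^ 6) := by ring
      _ = _ := by rw [h6, mul_one]
  rw [e]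

/-- [folklore] **(T2-sup, mixed directions `μ ≠ ν`) — WITH THE GENUINE BLOCK-EDGE LOGARITHM (owner (γ) l.21173, R-FP-20: a log-free GLOBAL sup bound is
«NOT THIS SHAPE»)**: `|Δ_μΔ_ν ghostRem N (·, x′)(x)| ≤ 162·A″(N)·K₂·N⁻⁴` with `A″(N) = 1296·(16·(97 + 64·log 3N) + 1)·C₂`, `C₂ = 16(4U + 10c₄ + Bmix)` of
`TwoPowerLegs.free`∕`free_sharp` (gan24 PART 5 `letterDiff₂_free`), `K₂` as in `abs_trace_secondDiff_ghostRem_le`; FOR ALL `N ≥ 1`, `x`, `x′`. -/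
theorem abs_mixedSecondDiff_ghostRem_le (hN : 1 ≤ N) {μ ν : Fin 4} (hμν : μ ≠ ν) (x x' : Pt) :
    |ghostRem (d := 3) N (x + unitVec μ + unitVec ν) x' - ghostRem (d := 3) N (x + unitVec μ) x'
        - ghostRem (d := 3) N (x + unitVec ν) x' + ghostRem (d := 3) N x x'|
      ≤ 162 * (1296 * (16 * (97 + 64 * Real.log ((3 * N : ℕ) : ℝ)) + 1)
              * (16 * (4 * free.U + 10 * c4 + free.Bmix (Classical.choose TwoPowerLegs.free_sharp))))
          * (1296 * ((cInv 4 1 + 1) * (Real.exp (deltaInv 4 1) * (Nat.factorial 5) / deltaInv 4 1 ^ 5))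
              * (6912 * 104977 * (8 * (2 * free.U + 2 * c4 + free.Bgrad))) + 1) * ((N : ℝ) ^ 4)⁻¹ := by
  have h := abs_secondDiff_ghostRem_le_of_coarseInv (N := N) (fun u v => (((N : ℝ)) ^ (4 + 2))⁻¹ * actionKer (N - 1) 1 u v) hN
    (coarseInv_hC (N := N)) (fun u w => hasSum_coarseInv_mul_bracket' (d := 4) (by norm_num) N u w)
    (fun a b v hab => letterOsc hN (fun i z => letterDiff_free i z) a b v hab) (unitVec μ) (unitVec ν)
    (fun x y => letterS'' hN μ ν (letterDiff₂_free hμν) x y) x x'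
  refine h.trans (le_of_eq ?_)
  have h6 : (((N : ℝ)) ^ (4 + 2))⁻¹ * (N : ℝ) ^ 6 = 1 := by rw [show 4 + 2 = 6 by norm_num]; field_simp
  have e : 1296 * ((cInv 4 1 + 1) * (((N : ℝ)) ^ (4 + 2))⁻¹ * (Real.exp (deltaInv 4 1) * (Nat.factorial 5) / deltaInv 4 1 ^ 5))
      * (6912 * 104977 * (8 * (2 * free.U + 2 * c4 + free.Bgrad))) * (N : ℝ) ^ 6
      = 1296 * ((cInv 4 1 + 1) * (Real.exp (deltaInv 4 1) * (Nat.factorial 5) / deltaInv 4 1 ^ 5))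
        * (6912 * 104977 * (8 * (2 * free.U + 2 * c4 + free.Bgrad))) := by
    calc _ = 1296 * ((cInv 4 1 + 1) * (Real.exp (deltaInv 4 1) * (Nat.factorial 5) / deltaInv 4 1 ^ 5))
          * (6912 * 104977 * (8 * (2 * free.U + 2 * c4 + free.Bgrad))) * ((((N : ℝ)) ^ (4 + 2))⁻¹ * (N : ℝ) ^ 6) := by ring
      _ = _ := by rw [h6, mul_one]
  rw [e]

end Summit.QuantumFields.BalabanUV.Beta.FP.ConstrainedGhostIRFinal
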